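import Literature.MathematicalPhysics.QuantumLattice.HubbardNNNHoppingTiling
import Literature.MathematicalPhysics.QuantumLattice.HubbardNNNHoppingRectSymmetries
import Literature.MathematicalPhysics.QuantumLattice.HubbardTorus2DEnergyDensity
import Literature.MathematicalPhysics.QuantumLattice.InfVolFermionStateDensity
import HarnessLib

/-!
# The thermodynamic limit of the ground-state energy density of the `t–t'` Hubbard model on the
# two-dimensional torus

Family `hubbard` (topic `MathematicalPhysics/QuantumLattice`). For the published `t–t'` Hubbard
Hamiltonian `hubbardRectTorusTT' L L t t' U` (nearest-neighbour hopping `t`, diagonal hopping `t'`,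
repulsion `U ≥ 0`; LeBlanc et al. PRX 5 (2015) 041041 eq. (1), Xu et al. Science 384 (2024) eq. (1))
on the tori `ℤ/Lℤ × ℤ/Lℤ`, the canonical ground-state energy per site at density `n ∈ [0, 2)`,
`E_{L×L}(N_L(n))/L²` with `N_L(n) = 2⌊nL²/2⌋` (`rectN`), converges as `L → ∞`
(`tendsto_groundEnergy_hubbardRectTorusTT'_square_div_sq`); the limit is `energyDensityTT' t t' U n`
(`tendsto_energyDensityTT'`), at `t' = 0` it is the tree's `energyDensity2D t U n`
(`energyDensityTT'_zero`), and it is an infimum in the sense of the finite-size **tiling lower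
bound** `energyDensityTT'_le`: `e(2m/L²) ≤ E_{L×L}(2m)/L² + (16|t| + 32|t'|)/L`. Certified bounds
valid on every large torus pass to the limit (`energyDensityTT'_ge_of_eventually_ge`,
`energyDensityTT'_le_of_eventually_le`; square-torus forms `…_torus` via
`groundEnergy_hubbardTorusTT'_eq_rect` of `HubbardNNNHoppingRectSymmetries.lean`).

Proof: verbatim the `t' = 0` chain (`HubbardOneParticleCost.lean`, `HubbardTorus2DEnergyDensity.lean`,
`HubbardEnergyDensityCertificateLimit.lean`) — Fekete along squares
(`tendsto_of_tiling_of_filling`) fed by the tiling and filling inequalities of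
`HubbardNNNHoppingTiling.lean`, the rounding of the density being absorbed by the volume-uniform
one-particle addition cost (`groundEnergy_twoGraph_succ_le`: averaging `⟨c†_kψ, H c†_kψ⟩` over the
orbitals with the commutator bounds `‖[H, c†_k]‖ ≤ K + K'` of `HubbardCommutatorBound.lean`, one per
bond set) — Ruelle, *Statistical Mechanics* (1969), §2.2, §3.3–3.4. Definition: `energyDensityTT'`
(a `limUnder`, used through its `Tendsto` theorem); everything else is proved.

## References

* D. Ruelle, *Statistical Mechanics: Rigorous Results* (Benjamin, 1969), §3.3 (thermodynamic limit
  of the ground-state energy density), §3.4 (continuity in the density). [cite: Ruelle1969, §3.3]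
* J. P. F. LeBlanc et al., Phys. Rev. X 5 (2015) 041041, eq. (1) and §5.3 (thermodynamic-limit
  energies of the `t–t'` model, `U/t = 8`, `t'/t = -0.2`). [cite: LeBlancEtAl2015, eq. (1)]
-/

noncomputable section

open Matrix Finset Filter Topology
open scoped ComplexOrder BigOperators Matrix.Norms.L2Operator InnerProductSpace

namespace Literature.MathematicalPhysics.QuantumLattice

namespace ThermodynamicLimit

/-! ### The one-particle addition cost for a two-graph Hamiltonian -/

section AddCost

variable {Λ : Type*} [LinearOrder Λ] [Fintype Λ] (G G' : SimpleGraph Λ) [DecidableRel G.Adj]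
  [DecidableRel G'.Adj]

/-- A normalised ground state exists in every sector `N ≤ 2|Λ|` of the two-graph Hamiltonian
(Hermitian, block diagonal in the particle number). [folklore] -/
private theorem exists_unit_groundState_twoGraph (t U t' U' : ℝ) {N : ℕ}
    (hN : N ≤ 2 * Fintype.card Λ) :
    ∃ ψ : Fock (Orb Λ), IsNParticle N ψ ∧ star ψ ⬝ᵥ ψ = 1 ∧
      (hamiltonian G t U + hamiltonian G' t' U') *ᵥ ψ =
        ((groundEnergy (hamiltonian G t U + hamiltonian G' t' U') N : ℝ) : ℂ) • ψ := by
  classical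
  set H := hamiltonian G t U + hamiltonian G' t' U' with hH
  have hc : N ≤ (Finset.univ : Finset (Orb Λ)).card := by rwa [Finset.card_univ, card_orb]
  obtain ⟨s₀, -, hs₀⟩ := Finset.exists_subset_card_eq hc
  have hp : ∃ s : Finset (Orb Λ), s.card = N := ⟨s₀, hs₀⟩
  have hpres : PreservesSectors H :=
    (LiebThm1.preservesSectors_hamiltonian G t U).add (LiebThm1.preservesSectors_hamiltonian G' t' U')
  have hinv : ∀ s s' : Finset (Orb Λ), ¬(s.card = N) → s'.card = N → H s s' = 0 := by
    intro s s' hs hs'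
    by_contra h
    have := hpres s s' h
    apply hs
    rw [card_eq_upPart_add_downPart, this.1, this.2, ← card_eq_upPart_add_downPart, hs']
  have hHerm : H.IsHermitian :=
    (LiebThm1.hamiltonian_isHermitian G t U).add (LiebThm1.hamiltonian_isHermitian G' t' U')
  obtain ⟨⟨v, hv, hv0, hHv⟩, -⟩ := sector_groundState H hHerm
    (fun s : Finset (Orb Λ) => s.card = N) hp hinv (nParticleSubmodule N) (fun v => Iff.rfl)
  obtain ⟨c, -, hc1⟩ := exists_smul_unit hv0
  refine ⟨c • v, Submodule.smul_mem _ c hv, hc1, ?_⟩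
  rw [mulVec_smul, hHv, smul_comm,
    groundEnergy_eq_minEnergyOn H N (nParticleSubmodule N) fun ψ => Iff.rfl]

omit [LinearOrder Λ] in
/-- The homogeneous variational bound `E(N) ⟨φ, φ⟩ ≤ Re ⟨φ, H φ⟩` on the `N`-particle sector, for any
matrix `H` (normalise `φ ≠ 0`). [folklore] -/
private theorem groundEnergy_mul_norm_le [LinearOrder Λ] (H : Matrix (Finset (Orb Λ)) (Finset (Orb Λ)) ℂ)
    {N : ℕ} {φ : Fock (Orb Λ)} (hφ : IsNParticle N φ) :
    groundEnergy H N * (star φ ⬝ᵥ φ).re ≤ (expect H φ).re := by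
  by_cases h0 : φ = 0
  · subst h0
    simp [expect]
  obtain ⟨c, hc0, hc1⟩ := exists_smul_unit h0
  have hmem : IsNParticle N (c • φ) := (nParticleSubmodule N).smul_mem c hφ
  have h2 : groundEnergy H N ≤ (expect H (c • φ)).re := groundEnergy_le_re_expect H hmem hc1
  have hcc : star c * c = ((‖c‖ ^ 2 : ℝ) : ℂ) := by
    rw [Complex.star_def, Complex.conj_mul']
    push_cast
    rfl
  unfold expect at h2
  rw [mulVec_smul, star_smul, smul_dotProduct, dotProduct_smul, smul_smul, hcc, smul_eq_mul,
    Complex.re_ofReal_mul] at h2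
  rw [star_smul, smul_dotProduct, dotProduct_smul, smul_smul, hcc, smul_eq_mul] at hc1
  have h1 : ‖c‖ ^ 2 * (star φ ⬝ᵥ φ).re = 1 := by
    have := congrArg Complex.re hc1
    rwa [Complex.re_ofReal_mul, Complex.one_re] at this
  have hpos : 0 < ‖c‖ ^ 2 := by positivity
  have key : ‖c‖ ^ 2 * (groundEnergy H N * (star φ ⬝ᵥ φ).re) ≤ ‖c‖ ^ 2 * (expect H φ).re :=
    calc ‖c‖ ^ 2 * (groundEnergy H N * (star φ ⬝ᵥ φ).re)
        = groundEnergy H N * (‖c‖ ^ 2 * (star φ ⬝ᵥ φ).re) := by ring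
      _ = groundEnergy H N := by rw [h1, mul_one]
      _ ≤ ‖c‖ ^ 2 * (expect H φ).re := h2
  exact le_of_mul_le_mul_left key hpos

/-- **The one-particle addition cost of a two-graph Hamiltonian.** On graphs `G`, `G'` of maximal
degree `≤ Δ`, `≤ Δ'`, adding one particle to an `N`-particle ground state of
`H = hamiltonian G t U + hamiltonian G' t' U'` costs on average at most `K = K_G + K_{G'}`,
`K_G = 2(2Δ+1)(2|t| + |U|)`, `K_{G'} = 2(2Δ'+1)(2|t'| + |U'|)`, per unit weight:
`E(N+1) ≤ E(N) + K · 2|Λ|/(2|Λ| - N)` for `N < 2|Λ|` (averaging `⟨c†_kψ, H c†_kψ⟩ =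
E ‖c†_kψ‖² + ⟨c†_kψ, [H, c†_k]ψ⟩` over the `2|Λ|` orbitals, `Σ ‖c†_kψ‖² = 2|Λ| - N`, and
`‖[H, c†_k]‖ ≤ K_G + K_{G'}` by `norm_commutator_hamiltonianWith_creation_le` for each bond set).
A volume-uniform Lipschitz bound in the density, Ruelle (1969) §3.4. [cite: Ruelle1969, §3.4] -/
theorem groundEnergy_twoGraph_succ_le {Δ Δ' : ℕ} (hΔ : ∀ x : Λ, #{y | G.Adj x y} ≤ Δ)
    (hΔ' : ∀ x : Λ, #{y | G'.Adj x y} ≤ Δ') (t U t' U' : ℝ) {N : ℕ}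
    (hN : N < 2 * Fintype.card Λ) :
    groundEnergy (hamiltonian G t U + hamiltonian G' t' U') (N + 1) ≤
      groundEnergy (hamiltonian G t U + hamiltonian G' t' U') N +
        ((2 * Δ + 1 : ℕ) * (2 * (2 * |t| + |U|)) + (2 * Δ' + 1 : ℕ) * (2 * (2 * |t'| + |U'|))) *
          (2 * Fintype.card Λ) / (2 * Fintype.card Λ - N) := by
  classical
  set H := hamiltonian G t U + hamiltonian G' t' U' with hH
  set E := groundEnergy H N with hE
  set E' := groundEnergy H (N + 1) with hE'
  set K : ℝ := (2 * Δ + 1 : ℕ) * (2 * (2 * |t| + |U|)) + (2 * Δ' + 1 : ℕ) * (2 * (2 * |t'| + |U'|))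
    with hK
  obtain ⟨ψ, hψN, hψ1, hHψ⟩ := exists_unit_groundState_twoGraph G G' t U t' U' hN.le
  -- trial vectors and weights
  set φ : Orb Λ → Fock (Orb Λ) := fun k => creation k *ᵥ ψ with hφ
  set w : Orb Λ → ℝ := fun k => (star (φ k) ⬝ᵥ φ k).re with hw
  have hφN : ∀ k, IsNParticle (N + 1) (φ k) := fun k => IsNParticle.creation_mulVec_holds hψN k
  -- total weight
  have hW : ∑ k, w k = 2 * Fintype.card Λ - N := by
    have h := congrArg Complex.re (sum_star_creation_mulVec_dotProduct hψN hψ1)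
    rw [Complex.re_sum] at h
    rw [show ∑ k, w k = ∑ k : Orb Λ, (star (creation k *ᵥ ψ) ⬝ᵥ (creation k *ᵥ ψ)).re from rfl, h]
    simp
  have hWpos : (0 : ℝ) < 2 * Fintype.card Λ - N := by
    have : (N : ℝ) < (2 * Fintype.card Λ : ℕ) := by exact_mod_cast hN
    push_cast at this
    linarith
  -- energies of the trial vectors
  have hnormψ : ‖(WithLp.toLp 2 ψ : EuclideanSpace ℂ (Finset (Orb Λ)))‖ = 1 := by
    have h := norm_toLp_sq ψ
    rw [hψ1, Complex.one_re] at h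
    rwa [pow_eq_one_iff_of_nonneg (norm_nonneg _) two_ne_zero] at h
  have hnormφ : ∀ k, ‖(WithLp.toLp 2 (φ k) : EuclideanSpace ℂ (Finset (Orb Λ)))‖ ≤ 1 := by
    intro k
    calc ‖(WithLp.toLp 2 (φ k) : EuclideanSpace ℂ (Finset (Orb Λ)))‖
        ≤ ‖creation k‖ * ‖(WithLp.toLp 2 ψ : EuclideanSpace ℂ (Finset (Orb Λ)))‖ :=
          norm_toLp_mulVec_le _ _
      _ ≤ 1 * 1 := by
          gcongr
          · exact norm_creation_le_one (ι := Orb Λ) k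
          · exact hnormψ.le
      _ = 1 := one_mul _
  have hcomm : ∀ k, ‖H * creation k - creation k * H‖ ≤ K := by
    intro k
    have h1 := norm_commutator_hamiltonianWith_creation_le G hΔ t U 0 (ofLex k).1 (ofLex k).2
    have h2 := norm_commutator_hamiltonianWith_creation_le G' hΔ' t' U' 0 (ofLex k).1 (ofLex k).2
    rw [hamiltonianWith_zero, abs_zero, mul_zero, add_zero] at h1 h2
    have hsplit : H * creation k - creation k * H =
        (hamiltonian G t U * creation k - creation k * hamiltonian G t U) +
          (hamiltonian G' t' U' * creation k - creation k * hamiltonian G' t' U') := by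
      simp only [hH, add_mul, mul_add]
      abel
    rw [hsplit]
    exact (norm_add_le _ _).trans (add_le_add h1 h2)
  have hen : ∀ k, (star (φ k) ⬝ᵥ (H *ᵥ φ k)).re ≤ E * w k + K := by
    intro k
    have hsplit : H *ᵥ φ k = (E : ℂ) • φ k + (H * creation k - creation k * H) *ᵥ ψ := by
      simp only [hφ]
      rw [sub_mulVec, ← mulVec_mulVec, ← mulVec_mulVec, hHψ, mulVec_smul]
      abel
    rw [hsplit, dotProduct_add, dotProduct_smul, smul_eq_mul, Complex.add_re, Complex.re_ofReal_mul,
      star_dotProduct_self_eq_re, Complex.ofReal_re]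
    have hX : ‖star (φ k) ⬝ᵥ ((H * creation k - creation k * H) *ᵥ ψ)‖ ≤ K := by
      refine (norm_star_dotProduct_mulVec_le _ _ _).trans ?_
      rw [hnormψ, mul_one]
      calc _ ≤ 1 * K := mul_le_mul (hnormφ k) (hcomm k) (norm_nonneg _) zero_le_one
        _ = K := one_mul K
    have hX' := (Complex.re_le_norm _).trans hX
    change E * w k + _ ≤ E * w k + K
    linarith
  -- variational bound on each trial vector, summed
  have hvar : ∀ k, E' * w k ≤ (star (φ k) ⬝ᵥ (H *ᵥ φ k)).re := fun k =>
    groundEnergy_mul_norm_le H (hφN k)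
  have hsum : E' * (2 * Fintype.card Λ - N) ≤ E * (2 * Fintype.card Λ - N) + K * (2 * Fintype.card Λ) := by
    have h1 : ∑ k, E' * w k ≤ ∑ k, (E * w k + K) :=
      Finset.sum_le_sum fun k _ => (hvar k).trans (hen k)
    rw [← Finset.mul_sum, hW, Finset.sum_add_distrib, ← Finset.mul_sum, hW, Finset.sum_const,
      Finset.card_univ, card_orb, nsmul_eq_mul] at h1
    push_cast at h1
    linarith
  rw [show E + K * (2 * Fintype.card Λ) / (2 * Fintype.card Λ - N) =
    (E * (2 * Fintype.card Λ - N) + K * (2 * Fintype.card Λ)) / (2 * Fintype.card Λ - N) by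
    field_simp]
  rw [le_div_iff₀ hWpos]
  exact hsum

/-- **Adding `d` particles below density `ν < 1` (per orbital)** to the two-graph Hamiltonian costs
at most `K/(1-ν)` each: `E(N + d) ≤ E(N) + d · K/(1-ν)` whenever `N + d ≤ ν · 2|Λ|`,
`K = 2(2Δ+1)(2|t|+|U|) + 2(2Δ'+1)(2|t'|+|U'|)`. [cite: Ruelle1969, §3.4] -/
theorem groundEnergy_twoGraph_add_le {Δ Δ' : ℕ} (hΔ : ∀ x : Λ, #{y | G.Adj x y} ≤ Δ)
    (hΔ' : ∀ x : Λ, #{y | G'.Adj x y} ≤ Δ') (t U t' U' : ℝ) {ν : ℝ} (hν : ν < 1) {N : ℕ} :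
    ∀ d : ℕ, ((N + d : ℕ) : ℝ) ≤ ν * (2 * Fintype.card Λ) →
      groundEnergy (hamiltonian G t U + hamiltonian G' t' U') (N + d) ≤
        groundEnergy (hamiltonian G t U + hamiltonian G' t' U') N +
          d * (((2 * Δ + 1 : ℕ) * (2 * (2 * |t| + |U|)) +
            (2 * Δ' + 1 : ℕ) * (2 * (2 * |t'| + |U'|))) / (1 - ν)) := by
  set K : ℝ := (2 * Δ + 1 : ℕ) * (2 * (2 * |t| + |U|)) + (2 * Δ' + 1 : ℕ) * (2 * (2 * |t'| + |U'|))
    with hK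
  intro d
  induction d with
  | zero => intro _; simp
  | succ d ih =>
      intro hd
      have hK0 : (0 : ℝ) ≤ K := by positivity
      have hd' : ((N + d : ℕ) : ℝ) ≤ ν * (2 * Fintype.card Λ) := by
        refine le_trans ?_ hd
        push_cast; linarith
      have h1 := ih hd'
      -- one more particle at particle number `N + d`
      have hlt : ((N + d : ℕ) : ℝ) < 2 * Fintype.card Λ := by
        have hc : (0 : ℝ) ≤ 2 * Fintype.card Λ := by positivity
        have : ((N + d : ℕ) : ℝ) + 1 ≤ ν * (2 * Fintype.card Λ) := by
          refine le_trans ?_ hd; push_cast; linarith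
        nlinarith
      have hlt' : N + d < 2 * Fintype.card Λ := by exact_mod_cast hlt
      have h2 := groundEnergy_twoGraph_succ_le G G' hΔ hΔ' t U t' U' hlt'
      rw [← hK] at h2
      -- the cost at `N + d` is at most `K / (1 - ν)`
      have hden : (1 - ν) * (2 * Fintype.card Λ) ≤ 2 * Fintype.card Λ - ((N + d : ℕ) : ℝ) := by
        nlinarith
      have hpos : (0 : ℝ) < 2 * Fintype.card Λ - ((N + d : ℕ) : ℝ) := by linarith
      have hpos' : (0 : ℝ) < (1 - ν) * (2 * Fintype.card Λ) := by
        have : (0 : ℝ) < 2 * Fintype.card Λ := by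
          have : (0 : ℝ) ≤ ((N + d : ℕ) : ℝ) := by positivity
          linarith
        exact mul_pos (by linarith) this
      have h3 : K * (2 * Fintype.card Λ) / (2 * Fintype.card Λ - ((N + d : ℕ) : ℝ)) ≤ K / (1 - ν) := by
        rw [div_le_div_iff₀ hpos (by linarith)]
        calc K * (2 * Fintype.card Λ) * (1 - ν) = K * ((1 - ν) * (2 * Fintype.card Λ)) := by ring
          _ ≤ K * (2 * Fintype.card Λ - ((N + d : ℕ) : ℝ)) := mul_le_mul_of_nonneg_left hden hK0
      have h2' : groundEnergy (hamiltonian G t U + hamiltonian G' t' U') (N + d + 1) ≤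
          groundEnergy (hamiltonian G t U + hamiltonian G' t' U') (N + d) + K / (1 - ν) := by
        linarith [h2, h3]
      rw [show N + (d + 1) = N + d + 1 by ring]
      have hcast : ((d + 1 : ℕ) : ℝ) = d + 1 := by push_cast; ring
      rw [hcast]
      nlinarith [h1, h2']

end AddCost

/-- Every site of `ℤ/aℤ × ℤ/bℤ` has at most four diagonal neighbours. [folklore] -/
private theorem card_filter_diag_adj_le (a b : ℕ) (p : Fin a ×ₗ Fin b) :
    #{q | (fermionRectTorusDiagGraph a b).Adj p q} ≤ 4 := by
  set x : ℕ := ((ofLex p).1 : ℕ) with hx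
  set y : ℕ := ((ofLex p).2 : ℕ) with hy
  calc #{q | (fermionRectTorusDiagGraph a b).Adj p q}
      ≤ #({((x + 1) % a, (y + 1) % b), ((x + 1) % a, (y + (b - 1)) % b),
            ((x + (a - 1)) % a, (y + 1) % b), ((x + (a - 1)) % a, (y + (b - 1)) % b)} :
          Finset (ℕ × ℕ)) := by
        refine Finset.card_le_card_of_injOn (fun q => (((ofLex q).1 : ℕ), ((ofLex q).2 : ℕ))) ?_ ?_
        · intro q hq
          rw [Finset.mem_coe, Finset.mem_filter, fermionRectTorusDiagGraph_adj_iff] at hq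
          simp only [Finset.coe_insert, Finset.coe_singleton, Set.mem_insert_iff,
            Set.mem_singleton_iff, Prod.mk.injEq]
          obtain ⟨-, ⟨-, h1 | h1⟩, ⟨-, h2 | h2⟩⟩ := hq
          · exact Or.inl ⟨h1.symm, h2.symm⟩
          · exact Or.inr (Or.inl ⟨h1.symm, eq_mod_of_succ_mod_eq (ofLex p).2.isLt (ofLex q).2.isLt h2⟩)
          · exact Or.inr (Or.inr (Or.inl
              ⟨eq_mod_of_succ_mod_eq (ofLex p).1.isLt (ofLex q).1.isLt h1, h2.symm⟩))
          · exact Or.inr (Or.inr (Or.inr ⟨eq_mod_of_succ_mod_eq (ofLex p).1.isLt (ofLex q).1.isLt h1,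
              eq_mod_of_succ_mod_eq (ofLex p).2.isLt (ofLex q).2.isLt h2⟩))
        · intro q _ q' _ h
          simp only [Prod.mk.injEq] at h
          exact ofLex.injective (Prod.ext (Fin.ext h.1) (Fin.ext h.2))
    _ ≤ 4 := Finset.card_le_four

/-- The one-particle cost constant of the `L × L` `t–t'` torus (both bond sets of degree `≤ 4`):
adding a particle below density `n < 2` per site costs at most
`A(n) = 36(2|t| + |U| + 2|t'|)/(2 - n)`. [cite: Ruelle1969, §3.4] -/
theorem groundEnergy_hubbardRectTorusTT'_square_add_le (L : ℕ) (t t' U : ℝ) {n : ℝ} (hn : n < 2)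
    {N d : ℕ} (h : ((N + d : ℕ) : ℝ) ≤ n * (L : ℝ) ^ 2) :
    groundEnergy (hubbardRectTorusTT' L L t t' U) (N + d) ≤
      groundEnergy (hubbardRectTorusTT' L L t t' U) N +
        d * (36 * (2 * |t| + |U| + 2 * |t'|) / (2 - n)) := by
  have hν : n / 2 < 1 := by linarith
  have h' : ((N + d : ℕ) : ℝ) ≤ n / 2 * (2 * Fintype.card (Fin L ×ₗ Fin L)) := by
    rw [card_rectSites]
    have h2 : n / 2 * (2 * ((L * L : ℕ) : ℝ)) = n * (L : ℝ) ^ 2 := by push_cast; ring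
    rw [h2]; exact h
  have := groundEnergy_twoGraph_add_le (fermionRectTorusGraph L L) (fermionRectTorusDiagGraph L L)
    (Δ := 4) (Δ' := 4) (card_filter_fermionRectTorusGraph_adj_le L L) (card_filter_diag_adj_le L L)
    t U t' 0 hν d h'
  unfold hubbardRectTorusTT'
  refine this.trans (le_of_eq ?_)
  congr 1
  have h2 : (2 : ℝ) - n ≠ 0 := by linarith
  have h1 : (1 : ℝ) - n / 2 ≠ 0 := by intro h; apply h2; linarith
  rw [abs_zero]
  push_cast
  field_simp
  ring

/-! ### The thermodynamic limit at fixed density -/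
set_option maxHeartbeats 400000 in
/-- **Existence of the thermodynamic limit of the ground-state energy density of the `t–t'` Hubbard
model on the two-dimensional torus at fixed density.** For all hoppings `t, t'`, repulsion `U ≥ 0`
and density `0 ≤ n < 2`, `E_{L×L}(2⌊nL²/2⌋)/L²` converges as `L → ∞`. Fekete along squares
(`tendsto_of_tiling_of_filling`) fed by the square tiling (defect `(16|t| + 32|t'|) M k (k+1)`), the
one-particle addition cost absorbing the rounding of the density (`≤ 2K²` extra particles at cost
`36(2|t|+|U|+2|t'|)/(2-n)` each), the complement filling, and the a priori bound `-(8|t| + 8|t'|)`.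
(Ruelle (1969) §2.2, §3.3, for the `t–t'` model of LeBlanc et al. (2015).) [cite: Ruelle1969, §3.3] -/
theorem tendsto_groundEnergy_hubbardRectTorusTT'_square_div_sq (t t' : ℝ) {U : ℝ} (hU : 0 ≤ U)
    {n : ℝ} (hn0 : 0 ≤ n) (hn2 : n < 2) :
    ∃ e : ℝ, Tendsto (fun L : ℕ =>
      groundEnergy (hubbardRectTorusTT' L L t t' U) (rectN n L) / (L : ℝ) ^ 2) atTop (𝓝 e) := by
  set A : ℝ := 36 * (2 * |t| + |U| + 2 * |t'|) / (2 - n) with hA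
  have h2n : 0 < 2 - n := by linarith
  have hA0 : 0 ≤ A := by positivity
  set M₀ : ℕ := ⌈1 / (2 - n)⌉₊ + 1 with hM₀
  have hM₀1 : 1 ≤ M₀ := Nat.le_add_left 1 _
  have hM₀n : 1 / (2 - n) ≤ M₀ := by
    have := Nat.le_ceil (1 / (2 - n))
    simp only [hM₀]; push_cast; linarith
  set b : ℕ → ℝ := fun L => groundEnergy (hubbardRectTorusTT' L L t t' U) (rectN n L) / (L : ℝ) ^ 2
    with hb
  have ht0 : 0 ≤ |t| := abs_nonneg t
  have ht'0 : 0 ≤ |t'| := abs_nonneg t'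
  refine tendsto_of_tiling_of_filling b (C := 16 * |t| + 32 * |t'| + U) (D := 2 * A)
    (c := 8 * |t| + 8 * |t'|) hM₀1 (by positivity) (by positivity) ?_ ?_ ?_
  · -- a priori lower bound
    intro M hM
    have hM1 : (1 : ℝ) ≤ M := by exact_mod_cast hM₀1.trans hM
    have hE := (groundEnergy_hubbardRectTorusTT'_mem_Icc M M t t' hU (rectN_le_two_mul hn0 hn2.le M)).1
    simp only [hb]
    rw [le_div_iff₀ (by positivity)]
    nlinarith
  · -- tiling
    intro k M hM
    have hM1 : (1 : ℝ) ≤ M := by exact_mod_cast hM₀1.trans hM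
    set K : ℕ := k + 1 with hK
    obtain ⟨hP1, hP2⟩ := sq_mul_rectN_le hn0 K M
    set P : ℕ := K * K * rectN n M with hP
    obtain ⟨d, hd⟩ : ∃ d, rectN n (K * M) = P + d := ⟨rectN n (K * M) - P, by omega⟩
    have hPr : (P : ℝ) = K * K * (rectN n M : ℝ) := by simp only [hP]; push_cast; ring
    have hdle : (d : ℝ) ≤ 2 * (K * K) := by
      have : (rectN n (K * M) : ℝ) = P + d := by exact_mod_cast hd
      linarith
    -- additions at the big torus
    have hadd := groundEnergy_hubbardRectTorusTT'_square_add_le (K * M) t t' U hn2 (N := P) (d := d)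
      (by rw [← hd]; exact rectN_le hn0 (K * M))
    -- tiling with constant block particle numbers
    have htile := groundEnergy_hubbardRectTorusTT'_square_tiling M t t' U k (fun _ _ => rectN n M)
      (fun _ _ => rectN_le_two_mul hn0 hn2.le M)
    simp only [Finset.sum_const, Finset.card_univ, Fintype.card_fin, smul_eq_mul, nsmul_eq_mul]
      at htile
    have hPK : (k + 1) * ((k + 1) * rectN n M) = P := by simp only [hP, hK]; ring
    rw [hPK] at htile
    -- assemble and divide by `(K M)²`
    have hKpos : (0 : ℝ) < K := by simp only [hK]; positivity
    have hMpos : (0 : ℝ) < M := by linarith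
    have hk : ((k : ℕ) : ℝ) + 1 = K := by simp only [hK]; push_cast; ring
    have hkK : (k : ℝ) ≤ K := by rw [← hk]; linarith
    set EM := groundEnergy (hubbardRectTorusTT' M M t t' U) (rectN n M) with hEM
    set EK := groundEnergy (hubbardRectTorusTT' (K * M) (K * M) t t' U) (P + d) with hEK
    rw [← hK] at htile
    rw [hk] at htile
    -- `E_{KM}(P+d) ≤ K² E_M + K² M (16|t| + 32|t'| + U) + K² (2A)`
    have hdA : (d : ℝ) * A ≤ 2 * (K * K) * A := mul_le_mul_of_nonneg_right hdle hA0
    have h16 : (16 * |t| + 32 * |t'|) * (M : ℝ) * k * K ≤ (16 * |t| + 32 * |t'|) * M * K * K := by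
      gcongr
    have hUK : 0 ≤ (K : ℝ) * K * M * U := by positivity
    have h1 : EK ≤ (K : ℝ) * K * EM + K * K * M * (16 * |t| + 32 * |t'| + U) + K * K * (2 * A) := by
      simp only [hEK, hA]
      nlinarith [hadd, htile, hdA, h16, hUK]
    -- divide
    have hbM : b M = EM / (M : ℝ) ^ 2 := rfl
    have hbK : b (K * M) = EK / ((K * M : ℕ) : ℝ) ^ 2 := by simp only [hb, hEK, hd]
    have hKM2 : (0 : ℝ) < ((K * M : ℕ) : ℝ) ^ 2 := by push_cast; positivity
    rw [hbK, hbM, div_le_iff₀ hKM2]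
    have : (EM / (M : ℝ) ^ 2 + (16 * |t| + 32 * |t'| + U) / M + 2 * A / (M : ℝ) ^ 2) *
        ((K * M : ℕ) : ℝ) ^ 2 =
        (K : ℝ) * K * EM + K * K * M * (16 * |t| + 32 * |t'| + U) + K * K * (2 * A) := by
      push_cast; field_simp
    rw [this]; exact h1
  · -- filling
    intro ℓ L hℓ hℓL
    have hℓ1 : 1 ≤ ℓ := hM₀1.trans hℓ
    have hL1 : 1 ≤ L := hℓ1.trans hℓL
    obtain ⟨r, rfl⟩ : ∃ r, L = ℓ + r := ⟨L - ℓ, by omega⟩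
    set NB : ℕ := rectN n (ℓ + r) - rectN n ℓ with hNB
    have hmono := rectN_mono_left hn0 (Nat.le_add_right ℓ r)
    have hsum : rectN n ℓ + NB = rectN n (ℓ + r) := by omega
    have hNBle : NB ≤ 2 * (r * ℓ + r * (ℓ + r)) := by
      rcases Nat.eq_zero_or_pos r with hr | hr
      · subst hr; simp [hNB]
      · have h1 := rectN_le hn0 (ℓ + r)
        have h2 := lt_rectN_add_two n ℓ
        have hNBr : (NB : ℝ) = rectN n (ℓ + r) - rectN n ℓ := by
          rw [hNB, Nat.cast_sub hmono]
        have hℓr : (1 : ℝ) ≤ r := by exact_mod_cast hr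
        have hℓ' : (M₀ : ℝ) ≤ ℓ := by exact_mod_cast hℓ
        -- `(2 - n)(L² - ℓ²) ≥ (2 - n)(2ℓ + 1) ≥ 2`
        have hgap : 2 ≤ (2 - n) * (((ℓ : ℝ) + r) ^ 2 - (ℓ : ℝ) ^ 2) := by
          have h3 : (2 : ℝ) * ℓ + 1 ≤ ((ℓ : ℝ) + r) ^ 2 - (ℓ : ℝ) ^ 2 := by nlinarith
          have h4 : 1 ≤ (2 - n) * M₀ := by
            rw [div_le_iff₀ h2n] at hM₀n; linarith
          nlinarith
        have key : (NB : ℝ) ≤ 2 * (r * ℓ + r * (ℓ + r) : ℕ) := by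
          rw [hNBr]; push_cast at h1 ⊢; nlinarith
        exact_mod_cast key
    have hfill := groundEnergy_hubbardRectTorusTT'_square_fill ℓ r t t' hU
      (rectN_le_two_mul hn0 hn2.le ℓ) hNBle
    rw [hsum] at hfill
    simp only [hb]
    have hℓpos : (0 : ℝ) < ℓ := by exact_mod_cast hℓ1
    have hLpos : (0 : ℝ) < ((ℓ + r : ℕ) : ℝ) := by exact_mod_cast hL1
    rw [mul_div_cancel₀ _ (by positivity), mul_div_cancel₀ _ (by positivity)]
    push_cast at hfill ⊢
    have hr0 : (0 : ℝ) ≤ r := by positivity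
    have hG0 : (0 : ℝ) ≤ ((ℓ : ℝ) + r) ^ 2 - (ℓ : ℝ) ^ 2 := by nlinarith
    have hG : (r : ℝ) * ℓ + r * (ℓ + r) = ((ℓ : ℝ) + r) ^ 2 - (ℓ : ℝ) ^ 2 := by ring
    rw [hG] at hfill
    -- `(8|t|+8|t'|+U) G + (8|t|+16|t'|)(2ℓ+r) ≤ (16|t|+32|t'|+U)(G + L)`, `G = L² - ℓ²`, `L = ℓ + r`
    nlinarith [hfill, mul_nonneg ht0 hG0, mul_nonneg ht'0 hG0, mul_nonneg hU (add_nonneg hℓpos.le hr0),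
      mul_nonneg ht0 hr0, mul_nonneg ht'0 hr0, mul_nonneg ht0 hℓpos.le, mul_nonneg ht'0 hℓpos.le]

/-! ### The limiting energy density `e(t, t', U, n)` -/

/-- **The ground-state energy density of the two-dimensional `t–t'` Hubbard model** at hoppings
`t` (nearest) and `t'` (diagonal), repulsion `U` and density `n` (electrons per site):
`e(n) = lim_{L→∞} E_{L×L}(2⌊nL²/2⌋)/L²`, the thermodynamic limit along the tori `ℤ/Lℤ × ℤ/Lℤ` of
the canonical ground-state energy per site of `hubbardRectTorusTT' L L t t' U` (`limUnder`; the limit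
exists for `U ≥ 0`, `0 ≤ n < 2` by `tendsto_groundEnergy_hubbardRectTorusTT'_square_div_sq`). This is
the quantity whose numerical values at `(U/t, n, t'/t) = (8, 1, -0.2)` LeBlanc et al. (2015) §5.3
benchmark (Ruelle (1969) §3.3 for the existence). [cite: Ruelle1969, §3.3]
[cite: LeBlancEtAl2015, eq. (1) and §5.3] -/
def energyDensityTT' (t t' U n : ℝ) : ℝ :=
  limUnder atTop (fun L : ℕ =>
    groundEnergy (hubbardRectTorusTT' L L t t' U) (rectN n L) / (L : ℝ) ^ 2)

/-- The defining limit: `E_{L×L}(N_L(n))/L² → e(t, t', U, n)` for `U ≥ 0`, `0 ≤ n < 2`.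
[cite: Ruelle1969, §3.3] -/
theorem tendsto_energyDensityTT' (t t' : ℝ) {U : ℝ} (hU : 0 ≤ U) {n : ℝ} (hn0 : 0 ≤ n)
    (hn2 : n < 2) :
    Tendsto (fun L : ℕ => groundEnergy (hubbardRectTorusTT' L L t t' U) (rectN n L) / (L : ℝ) ^ 2)
      atTop (𝓝 (energyDensityTT' t t' U n)) :=
  tendsto_nhds_limUnder (tendsto_groundEnergy_hubbardRectTorusTT'_square_div_sq t t' hU hn0 hn2)

/-- **At `t' = 0` the `t–t'` energy density is the tree's `energyDensity2D`** (the defining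
sequences coincide term by term, `hubbardRectTorusTT'_zero`). [cite: Ruelle1969, §3.3] -/
theorem energyDensityTT'_zero (t U n : ℝ) : energyDensityTT' t 0 U n = energyDensity2D t U n := by
  unfold energyDensityTT' energyDensity2D groundEnergyAt
  simp_rw [hubbardRectTorusTT'_zero]

/-- **The limit is an infimum (tiling lower bound at every finite size).** For `L ≥ 1` and an even
particle number `2m < 2L²`: `e(2m/L²) ≤ E_{L×L}(2m)/L² + (16|t| + 32|t'|)/L` (tile the `KL × KL`
torus by `K²` copies of the `L × L` torus, each carrying `2m` particles — no rounding — and let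
`K → ∞`). [cite: Ruelle1969, §3.3] -/
theorem energyDensityTT'_le (t t' : ℝ) {U : ℝ} (hU : 0 ≤ U) {L : ℕ} (hL : 1 ≤ L) {m : ℕ}
    (hm : m < L * L) :
    energyDensityTT' t t' U ((2 * m : ℕ) / (L : ℝ) ^ 2) ≤
      groundEnergy (hubbardRectTorusTT' L L t t' U) (2 * m) / (L : ℝ) ^ 2 + (16 * |t| + 32 * |t'|) / L := by
  set n : ℝ := (2 * m : ℕ) / (L : ℝ) ^ 2 with hn
  have hLpos : (0 : ℝ) < L := by exact_mod_cast hL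
  have hn0 : 0 ≤ n := by positivity
  have hn2 : n < 2 := by
    rw [hn, div_lt_iff₀ (by positivity)]
    have : ((2 * m : ℕ) : ℝ) < 2 * (L * L : ℕ) := by exact_mod_cast (by omega : 2 * m < 2 * (L * L))
    push_cast at this ⊢; nlinarith
  have hlim := tendsto_energyDensityTT' t t' hU hn0 hn2
  -- along the subsequence `K L`, `K = k + 1`
  have hsub : Tendsto (fun k : ℕ => (k + 1) * L) atTop atTop :=
    tendsto_atTop_mono (fun k => (Nat.le_succ k).trans (Nat.le_mul_of_pos_right _ hL)) tendsto_id
  have hlim' := hlim.comp hsub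
  refine le_of_tendsto' hlim' fun k => ?_
  simp only [Function.comp_apply]
  rw [rectN_div_mul hL (k + 1) m]
  have htile := groundEnergy_hubbardRectTorusTT'_square_tiling L t t' U k (fun _ _ => 2 * m)
    (fun _ _ => by omega)
  simp only [Finset.sum_const, Finset.card_univ, Fintype.card_fin, smul_eq_mul, nsmul_eq_mul]
    at htile
  have hE : groundEnergy (hubbardRectTorusTT' ((k + 1) * L) ((k + 1) * L) t t' U)
      ((k + 1) * (k + 1) * (2 * m)) ≤ ((k + 1 : ℕ) : ℝ) * ((k + 1 : ℕ) *
        groundEnergy (hubbardRectTorusTT' L L t t' U) (2 * m)) +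
        (16 * |t| + 32 * |t'|) * L * k * (k + 1) := by
    rw [show (k + 1) * (k + 1) * (2 * m) = (k + 1) * ((k + 1) * (2 * m)) by ring]
    exact htile
  have hK : (0 : ℝ) < (k : ℝ) + 1 := by positivity
  push_cast at hE ⊢
  have ht0 : 0 ≤ |t| := abs_nonneg t
  have ht'0 : 0 ≤ |t'| := abs_nonneg t'
  have hC0 : 0 ≤ 16 * |t| + 32 * |t'| := by positivity
  have hk1 : (k : ℝ) ≤ k + 1 := by linarith
  have h16 : (16 * |t| + 32 * |t'|) * (L : ℝ) * k * (k + 1) ≤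
      (16 * |t| + 32 * |t'|) * L * (k + 1) * (k + 1) := by gcongr
  set EK := groundEnergy (hubbardRectTorusTT' ((k + 1) * L) ((k + 1) * L) t t' U)
    ((k + 1) * (k + 1) * (2 * m)) with hEK
  set EL := groundEnergy (hubbardRectTorusTT' L L t t' U) (2 * m) with hEL
  have h1 : EK ≤ ((k : ℝ) + 1) ^ 2 * (EL + (16 * |t| + 32 * |t'|) * L) := by nlinarith [hE, h16]
  calc EK / (((k : ℝ) + 1) * L) ^ 2
      ≤ ((k : ℝ) + 1) ^ 2 * (EL + (16 * |t| + 32 * |t'|) * L) / (((k : ℝ) + 1) * L) ^ 2 :=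
        div_le_div_of_nonneg_right h1 (by positivity)
    _ = EL / (L : ℝ) ^ 2 + (16 * |t| + 32 * |t'|) / L := by
        field_simp

/-! ### Certified bounds on every large torus pass to the limit -/

/-- **Certified lower bounds pass to the thermodynamic limit.** If for all large `L`
`c + μ (N_L(n)/L² − n) ≤ E_{L×L}(N_L(n))/L²` for the `t–t'` model (`U ≥ 0`, `0 ≤ n < 2`), then
`c ≤ e(t, t', U, n)` (as in the `t' = 0` case, Han's thermodynamic-limit bootstrap read through
`tendsto_energyDensityTT'`). [cite: Ruelle1969, §3.3] -/
theorem energyDensityTT'_ge_of_eventually_ge (t t' : ℝ) {U : ℝ} (hU : 0 ≤ U) {n : ℝ} (hn0 : 0 ≤ n)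
    (hn2 : n < 2) {c μ : ℝ}
    (h : ∀ᶠ L : ℕ in atTop, c + μ * ((rectN n L : ℝ) / (L : ℝ) ^ 2 - n) ≤
      groundEnergy (hubbardRectTorusTT' L L t t' U) (rectN n L) / (L : ℝ) ^ 2) :
    c ≤ energyDensityTT' t t' U n := by
  have hl : Tendsto (fun L : ℕ => c + μ * ((rectN n L : ℝ) / (L : ℝ) ^ 2 - n)) atTop (𝓝 c) := by
    have h1 := ((tendsto_rectN_div_sq hn0).sub_const n).const_mul μ |>.const_add c
    simpa using h1
  exact le_of_tendsto_of_tendsto hl (tendsto_energyDensityTT' t t' hU hn0 hn2) h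

/-- **Certified upper bounds pass to the thermodynamic limit**: if for all large `L`
`E_{L×L}(N_L(n))/L² ≤ c + μ (N_L(n)/L² − n)` (e.g. exact Rayleigh quotients of trial states on every
large torus), then `e(t, t', U, n) ≤ c`. [cite: Ruelle1969, §3.3] -/
theorem energyDensityTT'_le_of_eventually_le (t t' : ℝ) {U : ℝ} (hU : 0 ≤ U) {n : ℝ} (hn0 : 0 ≤ n)
    (hn2 : n < 2) {c μ : ℝ}
    (h : ∀ᶠ L : ℕ in atTop, groundEnergy (hubbardRectTorusTT' L L t t' U) (rectN n L) / (L : ℝ) ^ 2 ≤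
      c + μ * ((rectN n L : ℝ) / (L : ℝ) ^ 2 - n)) :
    energyDensityTT' t t' U n ≤ c := by
  have hl : Tendsto (fun L : ℕ => c + μ * ((rectN n L : ℝ) / (L : ℝ) ^ 2 - n)) atTop (𝓝 c) := by
    have h1 := ((tendsto_rectN_div_sq hn0).sub_const n).const_mul μ |>.const_add c
    simpa using h1
  exact le_of_tendsto_of_tendsto (tendsto_energyDensityTT' t t' hU hn0 hn2) hl h

/-- **Bounds along a subsequence suffice** (the limit exists): if
`c + μ (N_L(n)/L² − n) ≤ E_{L×L}(N_L(n))/L²` for INFINITELY MANY `L` (e.g. only for even `L`, or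
only for `L` a multiple of a cluster side — certificates are often produced along such
subsequences), then `c ≤ e(t, t', U, n)`. [cite: Ruelle1969, §3.3] -/
theorem energyDensityTT'_ge_of_frequently_ge (t t' : ℝ) {U : ℝ} (hU : 0 ≤ U) {n : ℝ} (hn0 : 0 ≤ n)
    (hn2 : n < 2) {c μ : ℝ}
    (h : ∃ᶠ L : ℕ in atTop, c + μ * ((rectN n L : ℝ) / (L : ℝ) ^ 2 - n) ≤
      groundEnergy (hubbardRectTorusTT' L L t t' U) (rectN n L) / (L : ℝ) ^ 2) :
    c ≤ energyDensityTT' t t' U n := by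
  have hl : Tendsto (fun L : ℕ => c + μ * ((rectN n L : ℝ) / (L : ℝ) ^ 2 - n)) atTop (𝓝 c) := by
    have h1 := ((tendsto_rectN_div_sq hn0).sub_const n).const_mul μ |>.const_add c
    simpa using h1
  exact le_of_tendsto_of_tendsto_of_frequently hl (tendsto_energyDensityTT' t t' hU hn0 hn2) h

/-- Upper bounds along a subsequence suffice: if `E_{L×L}(N_L(n))/L² ≤ c + μ (N_L(n)/L² − n)` for
infinitely many `L`, then `e(t, t', U, n) ≤ c`. [cite: Ruelle1969, §3.3] -/
theorem energyDensityTT'_le_of_frequently_le (t t' : ℝ) {U : ℝ} (hU : 0 ≤ U) {n : ℝ} (hn0 : 0 ≤ n)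
    (hn2 : n < 2) {c μ : ℝ}
    (h : ∃ᶠ L : ℕ in atTop, groundEnergy (hubbardRectTorusTT' L L t t' U) (rectN n L) / (L : ℝ) ^ 2 ≤
      c + μ * ((rectN n L : ℝ) / (L : ℝ) ^ 2 - n)) :
    energyDensityTT' t t' U n ≤ c := by
  have hl : Tendsto (fun L : ℕ => c + μ * ((rectN n L : ℝ) / (L : ℝ) ^ 2 - n)) atTop (𝓝 c) := by
    have h1 := ((tendsto_rectN_div_sq hn0).sub_const n).const_mul μ |>.const_add c
    simpa using h1
  exact le_of_tendsto_of_tendsto_of_frequently (tendsto_energyDensityTT' t t' hU hn0 hn2) hl h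

/-- Lower bounds along the EVEN side lengths suffice: if the bound holds for all large even `L`
(`L = 2M`), then `c ≤ e(t, t', U, n)`. [cite: Ruelle1969, §3.3] -/
theorem energyDensityTT'_ge_of_eventually_ge_even (t t' : ℝ) {U : ℝ} (hU : 0 ≤ U) {n : ℝ}
    (hn0 : 0 ≤ n) (hn2 : n < 2) {c μ : ℝ}
    (h : ∀ᶠ M : ℕ in atTop, c + μ * ((rectN n (2 * M) : ℝ) / ((2 * M : ℕ) : ℝ) ^ 2 - n) ≤
      groundEnergy (hubbardRectTorusTT' (2 * M) (2 * M) t t' U) (rectN n (2 * M)) /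
        ((2 * M : ℕ) : ℝ) ^ 2) :
    c ≤ energyDensityTT' t t' U n := by
  refine energyDensityTT'_ge_of_frequently_ge t t' hU hn0 hn2 (μ := μ) ?_
  have hT : Tendsto (fun M : ℕ => 2 * M) atTop atTop :=
    Filter.tendsto_id.const_mul_atTop' (by norm_num)
  exact hT.frequently h.frequently

/-! ### The same statements along the square tori `hubbardTorusTT' L` (`FermionTorus 2 L`) -/

/-- The defining limit along the square tori of the tree (`E_{torus L} = E_{L×L}`,
`groundEnergy_hubbardTorusTT'_eq_rect`): `E_{(ℤ/Lℤ)²}(N_L(n))/L² → e(t, t', U, n)`.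
[cite: Ruelle1969, §3.3] -/
theorem tendsto_energyDensityTT'_torus (t t' : ℝ) {U : ℝ} (hU : 0 ≤ U) {n : ℝ} (hn0 : 0 ≤ n)
    (hn2 : n < 2) :
    Tendsto (fun L : ℕ => groundEnergy (hubbardTorusTT' L t t' U) (rectN n L) / (L : ℝ) ^ 2)
      atTop (𝓝 (energyDensityTT' t t' U n)) := by
  simp_rw [groundEnergy_hubbardTorusTT'_eq_rect]
  exact tendsto_energyDensityTT' t t' hU hn0 hn2

/-- Certified lower bounds on every large SQUARE torus `hubbardTorusTT' L` pass to the thermodynamic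
limit. [cite: Ruelle1969, §3.3] -/
theorem energyDensityTT'_ge_of_eventually_ge_torus (t t' : ℝ) {U : ℝ} (hU : 0 ≤ U) {n : ℝ}
    (hn0 : 0 ≤ n) (hn2 : n < 2) {c μ : ℝ}
    (h : ∀ᶠ L : ℕ in atTop, c + μ * ((rectN n L : ℝ) / (L : ℝ) ^ 2 - n) ≤
      groundEnergy (hubbardTorusTT' L t t' U) (rectN n L) / (L : ℝ) ^ 2) :
    c ≤ energyDensityTT' t t' U n := by
  refine energyDensityTT'_ge_of_eventually_ge t t' hU hn0 hn2 (μ := μ) ?_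
  filter_upwards [h] with L hL
  rwa [groundEnergy_hubbardTorusTT'_eq_rect] at hL

/-- Certified upper bounds on every large SQUARE torus pass to the thermodynamic limit.
[cite: Ruelle1969, §3.3] -/
theorem energyDensityTT'_le_of_eventually_le_torus (t t' : ℝ) {U : ℝ} (hU : 0 ≤ U) {n : ℝ}
    (hn0 : 0 ≤ n) (hn2 : n < 2) {c μ : ℝ}
    (h : ∀ᶠ L : ℕ in atTop, groundEnergy (hubbardTorusTT' L t t' U) (rectN n L) / (L : ℝ) ^ 2 ≤
      c + μ * ((rectN n L : ℝ) / (L : ℝ) ^ 2 - n)) :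
    energyDensityTT' t t' U n ≤ c := by
  refine energyDensityTT'_le_of_eventually_le t t' hU hn0 hn2 (μ := μ) ?_
  filter_upwards [h] with L hL
  rwa [groundEnergy_hubbardTorusTT'_eq_rect] at hL

/-- The tiling lower bound read on the square torus: `e(2m/L²) ≤ E_{(ℤ/Lℤ)²}(2m)/L² + (16|t| + 32|t'|)/L`.
[cite: Ruelle1969, §3.3] -/
theorem energyDensityTT'_le_torus (t t' : ℝ) {U : ℝ} (hU : 0 ≤ U) {L : ℕ} (hL : 1 ≤ L) {m : ℕ}
    (hm : m < L * L) :
    energyDensityTT' t t' U ((2 * m : ℕ) / (L : ℝ) ^ 2) ≤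
      groundEnergy (hubbardTorusTT' L t t' U) (2 * m) / (L : ℝ) ^ 2 + (16 * |t| + 32 * |t'|) / L := by
  rw [groundEnergy_hubbardTorusTT'_eq_rect]
  exact energyDensityTT'_le t t' hU hL hm

/-- `e_{t,t'}(0) ≤ 0`: the empty sector costs nothing on every torus — the vacuum is a unit
`0`-particle vector annihilated by both hopping Hamiltonians, so `E_{L×L}^{t,t'}(0) ≤ 0` — and the
tiling bound `energyDensityTT'_le` at `m = 0` gives `e(0) ≤ (16|t| + 32|t'|)/L` for every `L ≥ 1`.
Ruelle (1969) §3.3 (variational characterisation of the energy density); this is the vacuum endpoint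
of the convexity chords `n' ∈ [0, n₀]` at `t' ≠ 0` (at `t' = 0` it is `energyDensity2D_zero_le` via
`energyDensityTT'_zero`). [cite: Ruelle1969, §3.3] -/
theorem energyDensityTT'_density_zero_le (t t' : ℝ) {U : ℝ} (hU : 0 ≤ U) :
    energyDensityTT' t t' U 0 ≤ 0 := by
  have hvac : ∀ L : ℕ, groundEnergy (hubbardRectTorusTT' L L t t' U) 0 ≤ 0 := by
    intro L
    have hN : IsNParticle 0 (vacuum : Fock (Orb (Fin L ×ₗ Fin L))) := by
      intro s hs
      rw [vacuum, Pi.single_apply, if_neg]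
      exact fun h => hs (by rw [h, Finset.card_empty])
    have h1 : star (vacuum : Fock (Orb (Fin L ×ₗ Fin L))) ⬝ᵥ vacuum = 1 := by
      rw [vacuum, dotProduct_single, Pi.star_apply, Pi.single_eq_same, star_one, one_mul]
    have h := groundEnergy_le_re_expect (hubbardRectTorusTT' L L t t' U) hN h1
    rwa [expect, hubbardRectTorusTT', add_mulVec, hamiltonian_mulVec_vacuum,
      hamiltonian_mulVec_vacuum, add_zero, dotProduct_zero, Complex.zero_re] at h
  have h : ∀ ℓ : ℕ, 1 ≤ ℓ → energyDensityTT' t t' U 0 ≤ (16 * |t| + 32 * |t'|) / ℓ := by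
    intro ℓ hℓ
    have hm : 0 < ℓ * ℓ := Nat.mul_pos hℓ hℓ
    have h1 := energyDensityTT'_le t t' hU hℓ (m := 0) hm
    simp only [mul_zero, Nat.cast_zero, zero_div] at h1
    have hℓ2 : (0 : ℝ) ≤ (ℓ : ℝ) ^ 2 := by positivity
    have h2 : groundEnergy (hubbardRectTorusTT' ℓ ℓ t t' U) 0 / (ℓ : ℝ) ^ 2 ≤ 0 :=
      div_nonpos_of_nonpos_of_nonneg (hvac ℓ) hℓ2
    linarith
  refine le_of_forall_pos_lt_add fun ε hε => ?_
  obtain ⟨ℓ, hℓ⟩ := exists_nat_gt ((16 * |t| + 32 * |t'|) / ε)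
  have hℓpos : (0 : ℝ) < (ℓ : ℝ) + 1 := by positivity
  have h1 := h (ℓ + 1) (Nat.le_add_left 1 ℓ)
  push_cast at h1
  have h2 : (16 * |t| + 32 * |t'|) / ((ℓ : ℝ) + 1) < ε := by
    rw [div_lt_iff₀ hℓpos]
    rw [div_lt_iff₀ hε] at hℓ
    nlinarith [abs_nonneg t, abs_nonneg t']
  linarith

end ThermodynamicLimit

end Literature.MathematicalPhysics.QuantumLattice

end
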